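import Summits.AnomalousDissipation.AnomalousDissipation.Theorems.SolenoidalFractalHomogenisationLagrangianStepFrameToEulerian
import Literature.Analysis.FluidPDE.PassiveVectorTensorTimeDilation
import HarnessLib

/-!
# K1L_D (stmt-AnomalousDissipation-27980), `stub_Z7_alphaBeta` α-provider, (T1) in PHYSICAL time: the transfer hypothesis `hT1` of
# `isDistortedPropagator_conjProp_clamped`, modulo the carrier relation (helper; `--supports … --as helper`; lead-k1l-onelevel-p1 g5)

`isWeakTensorPassiveVectorOn_read` (p703414) produces the Eulerian reading at CELL time `τ` (carrier `(1/a)•B`, tensor `𝔸c`, horizon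
`a(t−jR) − σ₁`); `IsWeakTensorPassiveVectorOn.comp_mul_time` (time dilation by `a = a (m+1)`) turns it into the PHYSICAL-time statement
**`isWeakTensorPassiveVectorOn_read_phys`**: horizon `t − jR − σ₁/a`, carrier `τ′ ↦ B (jR + σ₁/a + τ′)`, tensor `a • 𝔸c`, datum
`φ ∘ X m jR (jR + σ₁/a)`, solution `τ′ x ↦ w (aτ′) (X m jR (jR + σ₁/a + τ′) x)` — literally the conclusion of the hypothesis `hT1` of
`FrameConj.isDistortedPropagator_conjProp_clamped` (p701146) with `s = jR`, for ANY continuous weakly solenoidal Eulerian carrier `B` tied to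
the frame carrier `bc` by `∇X · bc(σ₁+τ) = (1/a)(B − b_{≤m})(t′) ∘ X` on the open piece.  NOT a proof of the stub, of the crux, or of AD;
rung F-D1.A0.
-/

set_option linter.dupNamespace false  -- the summit-side namespace `Summit.AnomalousDissipation.AnomalousDissipation.…` repeats a component by design (D-0017)

noncomputable section

namespace Summit.AnomalousDissipation.AnomalousDissipation.Theorems.SolenoidalFractalHomogenisation.LagrangianStep.FrameConj

open Set Function Filter MeasureTheory Topology
open scoped NNReal ENNReal
open Literature.Analysis Literature.Analysis.FunctionSpaces Literature.Analysis.FunctionSpaces.Torus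
open Literature.Analysis.FluidPDE Literature.Analysis.FluidPDE.LatticeShear
open Literature.Analysis.FluidPDE.LatticeShear (LagrangianLatticeCarrier)

variable {k : ℕ}

/-- **(T1) in physical time, modulo the carrier relation.**  See the module docstring. -/
theorem isWeakTensorPassiveVectorOn_read_phys (E : LagrangianLatticeCarrier k) (hR : E.LevelRegular) {m : ℕ} (hF : E.IsFlow m)
    (j : ℤ) {t σ₁ : ℝ} (hjt : (j : ℝ) * E.refresh (m + 1) ≤ t) (htR : t ≤ (j : ℝ) * E.refresh (m + 1) + E.refresh (m + 1))
    (hσ₁ : 0 ≤ σ₁) (hσ₁T : σ₁ ≤ E.a (m + 1) * (t - (j : ℝ) * E.refresh (m + 1)))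
    {𝔸c : FluidPDE.Torus.Visc4 (Fin 3)} {bc B : ℝ → UnitAddTorus (Fin 3) → EuclideanSpace ℝ (Fin 3)}
    (hB : Continuous (uncurry B)) (hBdiv : ∀ t', Torus.IsWeaklyDivFree (B t'))
    (hRB : ∀ τ ∈ Ioo 0 (E.a (m + 1) * (t - (j : ℝ) * E.refresh (m + 1)) - σ₁), ∀ y,
      E.flowDeriv m ((j : ℝ) * E.refresh (m + 1) + (σ₁ + τ) / E.a (m + 1)) ((j : ℝ) * E.refresh (m + 1)) y (bc (σ₁ + τ) y)
        = (1 / E.a (m + 1)) • B ((j : ℝ) * E.refresh (m + 1) + (σ₁ + τ) / E.a (m + 1))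
            (E.X m ((j : ℝ) * E.refresh (m + 1) + (σ₁ + τ) / E.a (m + 1)) ((j : ℝ) * E.refresh (m + 1)) y)
          - (1 / E.a (m + 1)) • E.partialSum m ((j : ℝ) * E.refresh (m + 1) + (σ₁ + τ) / E.a (m + 1))
              (E.X m ((j : ℝ) * E.refresh (m + 1) + (σ₁ + τ) / E.a (m + 1)) ((j : ℝ) * E.refresh (m + 1)) y))
    {φ : UnitAddTorus (Fin 3) → EuclideanSpace ℝ (Fin 3)} (hφ : MemLp φ 2 volume)
    {w : ℝ → UnitAddTorus (Fin 3) → EuclideanSpace ℝ (Fin 3)}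
    (hw : FluidPDE.Torus.IsWeakTensorPassiveVectorDistortedOn 0 (E.a (m + 1) * (t - (j : ℝ) * E.refresh (m + 1)) - σ₁) 𝔸c
      (fun τ => bc (σ₁ + τ))
      (fun τ y => frameG E m ((j : ℝ) * E.refresh (m + 1) +
        max 0 (min (σ₁ + τ) (E.a (m + 1) * (t - (j : ℝ) * E.refresh (m + 1)))) / E.a (m + 1)) ((j : ℝ) * E.refresh (m + 1)) y) φ w) :
    FluidPDE.Torus.IsWeakTensorPassiveVectorOn 0 (t - (j : ℝ) * E.refresh (m + 1) - σ₁ / E.a (m + 1)) (E.a (m + 1) • 𝔸c)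
      (fun τ' => B ((j : ℝ) * E.refresh (m + 1) + σ₁ / E.a (m + 1) + τ'))
      (φ ∘ E.X m ((j : ℝ) * E.refresh (m + 1)) ((j : ℝ) * E.refresh (m + 1) + σ₁ / E.a (m + 1)))
      (fun τ' x => w (E.a (m + 1) * τ') (E.X m ((j : ℝ) * E.refresh (m + 1)) ((j : ℝ) * E.refresh (m + 1) + σ₁ / E.a (m + 1) + τ') x)) := by
  have ha : 0 < E.a (m + 1) := E.a_pos (m + 1)
  have ha' : E.a (m + 1) ≠ 0 := ha.ne'
  have hθ : Continuous fun τ : ℝ => (j : ℝ) * E.refresh (m + 1) + (σ₁ + τ) / E.a (m + 1) := by fun_prop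
  -- cell-time Eulerian carrier `(1/a) • B(t′ τ)`
  have hBt : Continuous (uncurry fun (τ : ℝ) (x : UnitAddTorus (Fin 3)) =>
      (1 / E.a (m + 1)) • B ((j : ℝ) * E.refresh (m + 1) + (σ₁ + τ) / E.a (m + 1)) x) := by
    have h := hB.comp ((hθ.comp continuous_fst).prodMk continuous_snd)
    exact h.const_smul (1 / E.a (m + 1))
  have hBtdiv : ∀ τ, Torus.IsWeaklyDivFree (fun x : UnitAddTorus (Fin 3) =>
      (1 / E.a (m + 1)) • B ((j : ℝ) * E.refresh (m + 1) + (σ₁ + τ) / E.a (m + 1)) x) := fun τ => (hBdiv _).const_smul' _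
  have h1 := isWeakTensorPassiveVectorOn_read E hR hF j hjt htR hσ₁ hσ₁T rfl
    (Bt := fun τ x => (1 / E.a (m + 1)) • B ((j : ℝ) * E.refresh (m + 1) + (σ₁ + τ) / E.a (m + 1)) x) hBt hBtdiv hRB hφ hw
  have h2 := h1.comp_mul_time ha
  -- identify horizon, carrier and solution after the time dilation
  have eT : (E.a (m + 1) * (t - (j : ℝ) * E.refresh (m + 1)) - σ₁) / E.a (m + 1)
      = t - (j : ℝ) * E.refresh (m + 1) - σ₁ / E.a (m + 1) := by
    field_simp
  have eclock : ∀ s : ℝ, (j : ℝ) * E.refresh (m + 1) + (σ₁ + E.a (m + 1) * s) / E.a (m + 1)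
      = (j : ℝ) * E.refresh (m + 1) + σ₁ / E.a (m + 1) + s := fun s => by
    field_simp; ring
  have eb : (fun (s : ℝ) (x : UnitAddTorus (Fin 3)) => E.a (m + 1) •
        (fun (τ : ℝ) (x : UnitAddTorus (Fin 3)) => (1 / E.a (m + 1)) • B ((j : ℝ) * E.refresh (m + 1) + (σ₁ + τ) / E.a (m + 1)) x)
          (E.a (m + 1) * s) x)
      = fun τ' => B ((j : ℝ) * E.refresh (m + 1) + σ₁ / E.a (m + 1) + τ') := by
    funext s x
    simp only [smul_smul, mul_one_div_cancel ha', one_smul, eclock]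
  have ew : (fun (s : ℝ) (x : UnitAddTorus (Fin 3)) =>
        (fun (τ : ℝ) (x : UnitAddTorus (Fin 3)) => w τ (E.X m ((j : ℝ) * E.refresh (m + 1))
          ((j : ℝ) * E.refresh (m + 1) + (σ₁ + τ) / E.a (m + 1)) x)) (E.a (m + 1) * s) x)
      = fun τ' x => w (E.a (m + 1) * τ') (E.X m ((j : ℝ) * E.refresh (m + 1))
          ((j : ℝ) * E.refresh (m + 1) + σ₁ / E.a (m + 1) + τ') x) := by
    funext s x
    simp only [eclock]
  rw [eT, eb, ew] at h2
  exact h2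

end Summit.AnomalousDissipation.AnomalousDissipation.Theorems.SolenoidalFractalHomogenisation.LagrangianStep.FrameConj

end
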